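import Mathlib
import HarnessLib
import Summits.NavierStokesRegularity.NavierStokesRegularity.Theses.LocalProductionFreeDoor
import Summits.NavierStokesRegularity.NavierStokesRegularity.Theorems.PlaneStrainDoorTargets

/-!
# Route `LocalProductionFreeDoor` (nsreg-p1 ROUND-15 door S16 «production-free window») — birth closer: the leaf `Target` (the door itself)

Moot-by-proof closer (nsreg-p6 g8 S16-family birth kit, DIRECTOR-NS g7 #22): the item text is closed BY NAME against the
landed theorems of `Theorems/PlaneStrainDoor*` (index HOME/ns-regularity-ideate-p6/KIT-INDEX-g8.md §C); statements are
nsreg-p1's r15/Sketch16 / `route-s16-family/bc/FamilyItems.lean` texts.  WHAT THIS IS NOT: not NS regularity — a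
CONDITIONAL one-window door under LOCAL SPACE–TIME Type I.
-/

noncomputable section

-- the summit and its single sub-problem share the name (CONVENTIONS §1)
set_option linter.dupNamespace false

open MeasureTheory Set Function Filter Topology Metric
open scoped RealInnerProductSpace InnerProductSpace NNReal ENNReal
open Literature.Analysis Literature.Analysis.FluidPDE
open Summit.NavierStokesRegularity.NavierStokesRegularity.Theorems.LocalSineTubeDoorLocalPointZoomGradSlices
open Summit.NavierStokesRegularity.NavierStokesRegularity.Theorems.LocalSineTubeDoorWindowFatou
open Summit.NavierStokesRegularity.NavierStokesRegularity.Theorems.PlaneStrainDoorZoomSpaceTimeDecay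
open Summit.NavierStokesRegularity.NavierStokesRegularity.Theorems.PlaneStrainDoorProfileWindowToSlab
open Summit.NavierStokesRegularity.NavierStokesRegularity.Theorems.PlaneStrainDoorProfileLiouvilles
open Summit.NavierStokesRegularity.NavierStokesRegularity.Theorems.PlaneStrainDoorTargets

namespace Summit.NavierStokesRegularity.NavierStokesRegularity.Theorems.LocalProductionFreeDoorTargetClose

/-- **The door `Target` holds outright** — it is the landed theorem `PlaneStrainDoorTargets.target_productionFree` verbatim
(capstone for `route close --proved`). -/
theorem target_proof : Summit.NavierStokesRegularity.NavierStokesRegularity.Theses.LocalProductionFreeDoor.Target :=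
  Summit.NavierStokesRegularity.NavierStokesRegularity.Theorems.PlaneStrainDoorTargets.target_productionFree

end Summit.NavierStokesRegularity.NavierStokesRegularity.Theorems.LocalProductionFreeDoorTargetClose

end
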